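import Summits.BirchSwinnertonDyer.BirchSwinnertonDyer.Theorems.GenusKolyvaginAtTwoVisiblePairAtTwoCasselsTateHlocCanonical
import Summits.BirchSwinnertonDyer.BirchSwinnertonDyer.Theorems.GenusKolyvaginAtTwoVisiblePairAtTwoCasselsTateLocalTerms
import Literature.NumberTheory.GaloisCohomology.PoitouTateNumberField
import HarnessLib

/-!
# Route `GenusKolyvaginAtTwo`, crux `KolyvaginExactAtTwo` (22137) → Q3-inner: exactness of the `ℚ`-pair
# instance with the Cassels–Tate pairing of THE invariant maps — `hPT'`, `hloc₁`, `hloc₂` DISCHARGED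

Seat `bsd-line-gk2-p2` g12 (cell `bsd-f1-sign2`). THEOREMS ONLY (no definition, no named fact, no `sorry`).

`selmer_eq_and_card_selmer_twin_eq_of_canonical`: the capstone `selmer_eq_and_card_selmer_twin_eq_of_localTerms`
(p661518) specialised to `inv := LocalInvariants.canonical ℚ (2^L · 2^L)` (THE invariant maps of local class field
theory): the reciprocity law `hPT'` is the tree's `sumInvLocalizationEqZero_canonical_of_numberField`, and McCallum's
Lemma 5.3 for the local terms at `λ` (`hloc₁`, `hloc₂`) is `hloc₁_canonical` / `hloc₂_canonical`
(`…CasselsTateHlocCanonical`), at the price of the Weil pairings' non-degeneracy (`hnondeg₁`, `hnondeg₂`, supplied with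
`e_i` by `exists_weilPairing_holds`). What stays displayed: the Weil-pairing data, `hH3 : Ш³(ℚ, μ_{2^{2L}}) = 0`
(Milne I Thm. 4.10(c)), the LEVEL-PAIRING property `hB₁`, `hB₂` of the two Cassels–Tate pairings at the even level
(Cassels' alternation at `p = 2` — not in the tree), `x ∈ δ(E(ℚ))` (`hx`) and gk2-p3's level-`2` inputs.

BSD is not proved by any of this.

References: [McCallumLMS1991] §4 Prop. 4.7, §5 Lemma 5.3, Thm. 5.4; [MilneADT2006] I Thm. 4.10, §6 Prop. 6.9,
Thm. 6.13(a); [CasselsFrohlichANT1967] Ch. VII §11.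
-/

set_option linter.dupNamespace false -- tree convention: `Summit.BirchSwinnertonDyer.BirchSwinnertonDyer.Theorems` (summit = sub-problem)
set_option autoImplicit false

noncomputable section

open scoped Classical

namespace Summit.BirchSwinnertonDyer.BirchSwinnertonDyer.Theorems.GenusExact.VisiblePairAtTwo

open WeierstrassCurve NumberField IsDedekindDomain Field Function Rat.HeightOneSpectrum
open Literature.NumberTheory.EllipticCurves Literature.NumberTheory.GaloisRepresentations
open Literature.NumberTheory.GaloisCohomology
open Literature.NumberTheory.GaloisRepresentations.DiscreteGaloisModule (mu)
open Literature.NumberTheory.EllipticCurves.KolyvaginDescent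
open Literature.GroupTheory.FiniteAbelian

section Capstone

variable {W : WeierstrassCurve ℚ} [W.IsElliptic] [W.IsGloballyMinimal] {K : Type} [Field K] [NumberField K]
  {L : ℕ} {θ : K} {hθ : θ ∉ Set.range (algebraMap ℚ K)}
  {hθsq : θ ^ 2 = algebraMap ℚ K ((NumberField.discr K : ℤ) : ℚ)} [(twin W K).IsElliptic]

/-- **Exactness of the `ℚ`-pair instance for the Cassels–Tate pairings of THE invariant maps**
(`inv = LocalInvariants.canonical`): `Sel_{2^M}(E/ℚ) = ℤ/2^M · x` and `#Sel_{2^M}(E^{(d_K)}/ℚ) = 2^{2M₀}` at the even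
level `M = L + L`, `2M₀ ≤ L`, from the inputs of `selmer_eq_and_card_selmer_twin_eq_of_localTerms` WITHOUT `hPT'`
(Tate's reciprocity law, `sumInvLocalizationEqZero_canonical_of_numberField`) and WITHOUT `hloc₁`/`hloc₂`
(McCallum's Lemma 5.3 at `λ`, `hloc₁_canonical`/`hloc₂_canonical`), given the non-degeneracy of the two Weil
pairings. [cite: McCallumLMS1991, §4 Prop. 4.7, §5 Lemma 5.3 and Thm. 5.4] [cite: MilneADT2006, Ch. I Thm. 4.10(b), §6 Prop. 6.9] -/
theorem selmer_eq_and_card_selmer_twin_eq_of_canonical (I : Input W K (L + L) hθ hθsq) (I₁ : Input W K 1 hθ hθsq)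
    (hcm : ¬ W.HasCM) (hΔ : W.Δ < 0) (hK : IsImaginaryQuadratic K) (hodd : Odd (NumberField.discr K))
    (hns : ¬ IsSquare ((NumberField.discr K : ℚ) * -|W.Δ|))
    (hρ : ∀ n : ℕ, W.HasSurjectiveModNGaloisRep (2 ^ n : ℕ)) (hL : 2 * I.M₀ ≤ L) (hL1 : 1 ≤ L)
    -- the Weil pairings on `E[2^L · 2^L]` and `E^{(d_K)}[2^L · 2^L]`
    (e₁ : geomTorsion W ((2 ^ L * 2 ^ L : ℕ) : ℤ) → geomTorsion W ((2 ^ L * 2 ^ L : ℕ) : ℤ) → AlgebraicClosure ℚ)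
    (hμ₁ : ∀ S T, e₁ S T ^ (2 ^ L * 2 ^ L) = 1)
    (hadd₁₁ : ∀ S₁ S₂ T, e₁ (S₁ + S₂) T = e₁ S₁ T * e₁ S₂ T)
    (hadd₂₁ : ∀ S T₁ T₂, e₁ S (T₁ + T₂) = e₁ S T₁ * e₁ S T₂)
    (hgal₁ : ∀ (σ : absoluteGaloisGroup ℚ) (S T : geomTorsion W ((2 ^ L * 2 ^ L : ℕ) : ℤ)),
      σ • e₁ S T = e₁ (σ • S) (σ • T))
    (halt₁ : ∀ T, e₁ T T = 1) (hnondeg₁ : ∀ T, (∀ S, e₁ S T = 1) → T = 0)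
    (e₂ : geomTorsion (twin W K) ((2 ^ L * 2 ^ L : ℕ) : ℤ) → geomTorsion (twin W K) ((2 ^ L * 2 ^ L : ℕ) : ℤ) →
      AlgebraicClosure ℚ)
    (hμ₂ : ∀ S T, e₂ S T ^ (2 ^ L * 2 ^ L) = 1)
    (hadd₁₂ : ∀ S₁ S₂ T, e₂ (S₁ + S₂) T = e₂ S₁ T * e₂ S₂ T)
    (hadd₂₂ : ∀ S T₁ T₂, e₂ S (T₁ + T₂) = e₂ S T₁ * e₂ S T₂)
    (hgal₂ : ∀ (σ : absoluteGaloisGroup ℚ) (S T : geomTorsion (twin W K) ((2 ^ L * 2 ^ L : ℕ) : ℤ)),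
      σ • e₂ S T = e₂ (σ • S) (σ • T))
    (halt₂ : ∀ T, e₂ T T = 1) (hnondeg₂ : ∀ T, (∀ S, e₂ S T = 1) → T = 0)
    (hH3 : ∀ c : galoisCohomology (mu ℚ (2 ^ L * 2 ^ L)) 3,
      (∀ v : Place ℚ, galoisCohomology.localization (mu ℚ (2 ^ L * 2 ^ L)) v 3 c = 0) → c = 0)
    (hB₁ : IsLevelPairing (2 ^ L) (ctLevelPairing W (2 ^ L) e₁ hμ₁ hadd₁₁ hadd₂₁ hgal₁
      (LocalInvariants.canonical ℚ (2 ^ L * 2 ^ L)) halt₁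
      (sumInvLocalizationEqZero_canonical_of_numberField ℚ (2 ^ L * 2 ^ L)) hH3
      (localTerm_finite_support (W := W) (m := 2 ^ L) (e := e₁) (hμ := hμ₁) (hadd₁ := hadd₁₁) (hadd₂ := hadd₂₁)
        (hgal := hgal₁) halt₁ (LocalInvariants.canonical ℚ (2 ^ L * 2 ^ L)))))
    (hB₂ : IsLevelPairing (2 ^ L) (ctLevelPairing (twin W K) (2 ^ L) e₂ hμ₂ hadd₁₂ hadd₂₂ hgal₂
      (LocalInvariants.canonical ℚ (2 ^ L * 2 ^ L)) halt₂
      (sumInvLocalizationEqZero_canonical_of_numberField ℚ (2 ^ L * 2 ^ L)) hH3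
      (localTerm_finite_support (W := twin W K) (m := 2 ^ L) (e := e₂) (hμ := hμ₂) (hadd₁ := hadd₁₂)
        (hadd₂ := hadd₂₂) (hgal := hgal₂) halt₂ (LocalInvariants.canonical ℚ (2 ^ L * 2 ^ L)))))
    (hx : torsionH1ToH1 W (lvl (L + L)) I.x = 0)
    -- the shallow certificate, in class form, and the remaining level-`2` inputs
    {ℓ₀ : ℕ} (hkol₀ : kolPrime W K 1 ℓ₀) (hy0 : I₁.c₂ ℓ₀ ≠ 0) (h0 : I₁.c₁ 1 = 0)
    (h44ord : ∀ ℓ, kolPrime W K (L + L) ℓ → ℓ ≠ ℓ₀ →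
      (I₁.c₁ (ℓ * ℓ₀) ∈ a₁ W 1 ℓ₀ ↔ I₁.c₂ ℓ ∈ a₂ W K 1 ℓ₀))
    (hι : ∀ ℓ, kolPrime W K (L + L) ℓ → torsionH1OfDvd (twin W K) (lvl_one_dvd_lvl (hL1.trans (Nat.le_add_right L L)))
      (I₁.c₂ ℓ) = ((2 : ℤ) ^ (L + L - 1)) • I.c₂ ℓ) :
    selmerGroup W (lvl (L + L)) = AddSubgroup.zmultiples I.x ∧
      Nat.card (selmerGroup (twin W K) (lvl (L + L))) = 2 ^ (2 * I.M₀) :=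
  selmer_eq_and_card_selmer_twin_eq_of_localTerms I I₁ hcm hΔ hK hodd hns hρ hL hL1 e₁ hμ₁ hadd₁₁ hadd₂₁ hgal₁
    halt₁ e₂ hμ₂ hadd₁₂ hadd₂₂ hgal₂ halt₂ (LocalInvariants.canonical ℚ (2 ^ L * 2 ^ L))
    (sumInvLocalizationEqZero_canonical_of_numberField ℚ (2 ^ L * 2 ^ L)) hH3 hB₁ hB₂ hx
    (hloc₁_canonical I (by omega) hL1 e₁ hμ₁ hadd₁₁ hadd₂₁ hgal₁ halt₁ hnondeg₁)
    (hloc₂_canonical I (by omega) hL1 e₂ hμ₂ hadd₁₂ hadd₂₂ hgal₂ halt₂ hnondeg₂)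
    hkol₀ hy0 h0 h44ord hι

end Capstone

end Summit.BirchSwinnertonDyer.BirchSwinnertonDyer.Theorems.GenusExact.VisiblePairAtTwo

end
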